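import Summits.BirchSwinnertonDyer.BirchSwinnertonDyer.Theorems.ByReductionTypeAtTwoMultTowerNS2LocalLayerIndex
import Summits.BirchSwinnertonDyer.BirchSwinnertonDyer.Theorems.ByReductionTypeAtTwoMultTowerNS2LocalLayerField
import Summits.BirchSwinnertonDyer.BirchSwinnertonDyer.Theorems.ByReductionTypeAtTwoMultTowerNS2TwistedTateAlgebra
import Literature.NumberTheory.EllipticCurves.Kato2004.IwasawaH1ReductionInfty
import HarnessLib

/-!
# Route `ByReductionTypeAtTwo`, crux `MultUpperHalfAtTwo` (item stmt-BirchSwinnertonDyer-19922), TOWER road, the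
# «ONE BIT AT A SPLIT MULTIPLICATIVE PRIME» rows: tower algebra at ANY prime `p` — topological generators of the local
# layer subgroups, finite levels, and cyclic Hilbert 90 for `⟨g⟩` acting on `K̄_v^{H_{n+R}}`

HONEST FRAMING (cell `bsd-2adic`, run/shared/lean/pub/bsd-2adic/, seat `bsd-2adic-tower-1` GEN 10, HUMAN RULINGS
D-0036 / D-0054 / D-0074): TOOL theorems only (no definition, no named fact, no `sorry`); closes nothing by itself;
nothing booked; BSD is not proved by any of this. These are the `p`-general versions of three bricks of the seat's GEN 9
kernelisation of `hNS2one` (`…MultTowerNS2TowerCosets.lean`, `…MultTowerNS2TwistedTateAlgebra.lean`, stated there for the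
cyclotomic `ℤ₂`-extension and the twisted field `K̄^{H ∩ Stab t}`), needed for the KERNEL PROOF of the PRINT binder
`hSP1 = Greenberg1999.sec3_natCard_pTorsion_localTowerKerPrimary_le_splitMultiplicative_rat` (Greenberg, LNM 1716, §3,
pp. 91–92: at a SPLIT multiplicative `v ∣ p` the local tower kernel is a subgroup of `ℚ_p/ℤ_p`, so `#𝒦_{v,n}[p] ≤ p`),
file `…MultTowerSplitOneBitHolds.lean` (cell memo HOME/mult/NOTE-SP1ONE.md §5).
Setting: `p` any prime, `κ` the cyclotomic `ℤ_p`-extension of `ℚ`, `v ∋ p`, `K = ℚ_v`, `Γ = Gal(K̄/K)`,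
`H_m = localSubgroup (κ.layerSubgroup m) K`, `H_∞ = localSubgroup κ.kerSubgroup K`, `F_m = K̄^{H_m}`.

* `exists_units_kappa_resGal_eq_of_generate` — for `g ∈ H_n` generating `H_n` topologically together with `H_∞`
  (the binder shape of BRICK 11 `MultTowerNS2.finite_torsionBy_localTowerKerPrimary_and_card_le`): `κ(res g) = p^n·u`, `u ∈ ℤ_pˣ`;
* `pow_mem_localSubgroup_layerSubgroup_iff` — `g^i ∈ H_{n+R} ↔ p^R ∣ i` for such `g`;
* `localSubgroup_layerSubgroup_antitone`, `mem_localSubgroup_kerSubgroup_of_forall` (`⋂ H_m = H_∞`; any `K`, `E`),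
  `exists_forall_mem_localSubgroup_layerSubgroup_smul_eq` — **finite level**: an element of `K̄` fixed by `H_∞` is fixed
  by some `H_m` (compactness of `Γ`);
* `smul_mem_fixedField_of_normal` — `K̄^{N}` is `Γ`-stable for `N ⊴ Γ`;
* `prod_smul_pow`, `smul_prod_smul_eq`, `prod_smul_range_mul_eq_pow` — orbit products `N_m(w) = ∏_{i<m} g^i w`:
  `N_m(w^k) = N_m(w)^k`, `g N_m(w) = N_m(w)` and `N_{mk}(w) = N_m(w)^k` when `g^m w = w`;
* `exists_eq_smul_div_of_prod_smul_eq_one` — **cyclic Hilbert 90 for the local layer**: `u ∈ F_{n+R}` with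
  `∏_{i<p^R} g^i u = 1` is `g(y)/y` with `y ∈ F_{n+R}ˣ` (Artin's independence of characters + Lagrange resolvent).

References: L. Washington, *Introduction to Cyclotomic Fields*, §13.1; J. Neukirch, *ANT* IV §1, IV (3.5);
E. Artin, *Galois Theory* (independence of characters); cell memo NOTE-SP1ONE.md §5.
-/

set_option autoImplicit false
-- the Theorems namespace of this sub repeats the summit name by design (D-0017 nested layout: Summit.<S>.<Sub>)
set_option linter.dupNamespace false

noncomputable section

open scoped Classical IntermediateField

universe u

namespace Summit.BirchSwinnertonDyer.BirchSwinnertonDyer.Theorems.MultTowerSP1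

open NumberField IsDedekindDomain Field PadicInt Literature.NumberTheory.EllipticCurves
  Literature.NumberTheory.GaloisRepresentations

variable {p : ℕ} [Fact p.Prime] {κ : ZpExtension ℚ p}

/-! ### `κ(res g)` for a topological generator -/

/-- **`κ(res g) = p^n · u`, `u` a unit**, for `g ∈ H_n` generating `H_n` topologically together with `H_∞` (otherwise
`g ∈ H_{n+1}`, an open subgroup containing `H_∞`, and `H_n ≤ H_{n+1}` contradicts `[H_n : H_{n+1}] = p`, BRICK 8).
The `p`-general form of `MultTowerNS2.exists_units_kappa_resGal_eq_of_generate`. [cite: Washington1997, §13.1] -/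
theorem exists_units_kappa_resGal_eq_of_generate (hκ : κ.IsCyclotomic) (v : HeightOneSpectrum (𝓞 ℚ))
    (hv : ((p : ℕ) : 𝓞 ℚ) ∈ v.asIdeal) (n : ℕ) {g : absoluteGaloisGroup (v.adicCompletion ℚ)}
    (hg : g ∈ localSubgroup (κ.layerSubgroup n) (v.adicCompletion ℚ))
    (hgen : ∀ U : Subgroup (absoluteGaloisGroup (v.adicCompletion ℚ)),
      IsOpen (U : Set (absoluteGaloisGroup (v.adicCompletion ℚ))) →
        localSubgroup κ.kerSubgroup (v.adicCompletion ℚ) ≤ U → g ∈ U →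
          localSubgroup (κ.layerSubgroup n) (v.adicCompletion ℚ) ≤ U) :
    ∃ u : ℤ_[p]ˣ, ((κ (resGal (K := ℚ) (v.adicCompletion ℚ) g)).toAdd : ℤ_[p]) = (p : ℤ_[p]) ^ n * (u : ℤ_[p]) := by
  rw [mem_localSubgroup_iff, ZpExtension.mem_layerSubgroup] at hg
  obtain ⟨b, hb⟩ := hg
  by_cases hbu : IsUnit b
  · exact ⟨hbu.unit, by rw [IsUnit.unit_spec]; exact hb⟩
  exfalso
  -- `p ∣ b`, so `g ∈ H_{n+1}`
  have hb1 : ‖b‖ < 1 := lt_of_le_of_ne (PadicInt.norm_le_one b) (fun h ↦ hbu (PadicInt.isUnit_iff.mpr h))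
  rw [PadicInt.norm_lt_one_iff_dvd] at hb1
  obtain ⟨c, rfl⟩ := hb1
  have hg1 : g ∈ localSubgroup (κ.layerSubgroup (n + 1)) (v.adicCompletion ℚ) := by
    rw [mem_localSubgroup_iff, ZpExtension.mem_layerSubgroup]
    exact ⟨c, by rw [hb]; ring⟩
  have hle := hgen _ (MultTowerNS2.isOpen_localSubgroup _ (κ.isOpen_layerSubgroup (n + 1)) _)
    (fun τ hτ ↦ by
      rw [mem_localSubgroup_iff] at hτ ⊢
      exact κ.kerSubgroup_le_layerSubgroup (n + 1) hτ) hg1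
  have hidx := MultTowerNS2.relIndex_localSubgroup_layerSubgroup_succ hκ v hv n
  rw [Subgroup.relIndex_eq_one.mpr hle] at hidx
  exact (Fact.out : p.Prime).one_lt.ne hidx

/-- **`g^i ∈ H_{n+R} ↔ p^R ∣ i`** for `g` with `κ(res g) = p^n u`, `u` a unit. The `p`-general form of
`MultTowerNS2.pow_mem_localSubgroup_layerSubgroup_iff`. [cite: Washington1997, §13.1] -/
theorem pow_mem_localSubgroup_layerSubgroup_iff (v : HeightOneSpectrum (𝓞 ℚ)) (n R : ℕ)
    {g : absoluteGaloisGroup (v.adicCompletion ℚ)} {u : ℤ_[p]ˣ}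
    (hu : ((κ (resGal (K := ℚ) (v.adicCompletion ℚ) g)).toAdd : ℤ_[p]) = (p : ℤ_[p]) ^ n * (u : ℤ_[p])) (i : ℕ) :
    g ^ i ∈ localSubgroup (κ.layerSubgroup (n + R)) (v.adicCompletion ℚ) ↔ p ^ R ∣ i := by
  rw [mem_localSubgroup_iff, ZpExtension.mem_layerSubgroup]
  simp only [map_pow, toAdd_pow, hu, nsmul_eq_mul, pow_add]
  have hpn : (p : ℤ_[p]) ^ n ≠ 0 := pow_ne_zero _ (NeZero.ne _)
  rw [show (i : ℤ_[p]) * ((p : ℤ_[p]) ^ n * (u : ℤ_[p])) = (p : ℤ_[p]) ^ n * ((i : ℤ_[p]) * u) by ring,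
    mul_dvd_mul_iff_left hpn, Units.dvd_mul_right,
    show ((i : ℤ_[p])) = ((i : ℤ) : ℤ_[p]) by push_cast; rfl, PadicInt.pow_p_dvd_int_iff]
  exact_mod_cast Iff.rfl

/-! ### Finite levels -/

section AnyField

variable {K : Type u} [Field K] (κK : ZpExtension K p) (E : Type u) [Field E] [Algebra K E]

/-- The local layer subgroups decrease: `H_{E,m'} ≤ H_{E,m}` for `m ≤ m'` (any `ℤ_p`-extension of any field `K`, any
`K`-field `E`). [cite: Washington1997, §13.1] -/
theorem localSubgroup_layerSubgroup_antitone {m m' : ℕ} (h : m ≤ m') :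
    localSubgroup (κK.layerSubgroup m') E ≤ localSubgroup (κK.layerSubgroup m) E :=
  Subgroup.comap_mono (κK.layerSubgroup_antitone h)

/-- `⋂_m H_{E,m} = H_{E,∞}`: an element of `Γ_E` lying in every local layer subgroup lies in the local kernel subgroup
(its image in `Γ_K` lies in every `κ⁻¹(p^m ℤ_p)`, hence in `ker κ`: `ZpExtension.mem_kerSubgroup_of_forall_mem_layerSubgroup`).
[cite: Washington1997, §13.1] -/
theorem mem_localSubgroup_kerSubgroup_of_forall {σ : absoluteGaloisGroup E}
    (hσ : ∀ m, σ ∈ localSubgroup (κK.layerSubgroup m) E) : σ ∈ localSubgroup κK.kerSubgroup E := by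
  rw [mem_localSubgroup_iff]
  exact ZpExtension.mem_kerSubgroup_of_forall_mem_layerSubgroup κK fun m ↦ (mem_localSubgroup_iff _ _ _).mp (hσ m)

end AnyField

/-- **Finite level**: if `x ∈ K̄_v` is fixed by every element of `H_∞`, then for some `m` it is fixed by every element
of `H_m` — the sets `H_m ∖ Fix(x)` are compact, decreasing in `m`, with empty intersection. The `p`-general form of
`MultTowerNS2.exists_forall_mem_localSubgroup_layerSubgroup_smul_eq` (case `S = ⊤`). [cite: NeukirchANT1999, Ch. IV §1] -/
theorem exists_forall_mem_localSubgroup_layerSubgroup_smul_eq (v : HeightOneSpectrum (𝓞 ℚ))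
    (x : AlgebraicClosure (v.adicCompletion ℚ))
    (hx : ∀ h ∈ localSubgroup κ.kerSubgroup (v.adicCompletion ℚ), h • x = x) :
    ∃ m : ℕ, ∀ h ∈ localSubgroup (κ.layerSubgroup m) (v.adicCompletion ℚ), h • x = x := by
  -- the open subgroup `U = Gal(K̄/K(x))` of elements fixing `x`
  let H : ℕ → Subgroup (absoluteGaloisGroup (v.adicCompletion ℚ)) :=
    fun m ↦ localSubgroup (κ.layerSubgroup m) (v.adicCompletion ℚ)
  have hHanti : ∀ m, H (m + 1) ≤ H m := fun m ↦ MultTowerNS2.localSubgroup_layerSubgroup_succ_le (κ := κ) v m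
  have hHopen : ∀ m, IsOpen (H m : Set (absoluteGaloisGroup (v.adicCompletion ℚ))) :=
    fun m ↦ MultTowerNS2.isOpen_localSubgroup _ (κ.isOpen_layerSubgroup m) _
  have hHker : ∀ σ : absoluteGaloisGroup (v.adicCompletion ℚ), (∀ m, σ ∈ H m) →
      σ ∈ localSubgroup κ.kerSubgroup (v.adicCompletion ℚ) := fun σ h ↦
    mem_localSubgroup_kerSubgroup_of_forall κ (v.adicCompletion ℚ) h
  have hint : IsIntegral (v.adicCompletion ℚ) x := Algebra.IsIntegral.isIntegral x
  haveI : FiniteDimensional (v.adicCompletion ℚ) (v.adicCompletion ℚ)⟮x⟯ := IntermediateField.adjoin.finiteDimensional hint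
  let U : Subgroup (absoluteGaloisGroup (v.adicCompletion ℚ)) := ((v.adicCompletion ℚ)⟮x⟯).fixingSubgroup
  have hUopen : IsOpen (U : Set (absoluteGaloisGroup (v.adicCompletion ℚ))) :=
    IntermediateField.fixingSubgroup_isOpen _
  have hUfix : ∀ σ ∈ U, σ • x = x := fun σ hσ ↦
    (IntermediateField.mem_fixingSubgroup_iff _ _).mp hσ x (IntermediateField.mem_adjoin_simple_self _ x)
  have hfixU : ∀ σ : absoluteGaloisGroup (v.adicCompletion ℚ), σ • x = x → σ ∈ U := by
    intro σ hσ
    have hle : (v.adicCompletion ℚ)⟮x⟯ ≤ IntermediateField.fixedField (Subgroup.zpowers σ) := by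
      rw [IntermediateField.adjoin_simple_le_iff, IntermediateField.mem_fixedField_iff]
      rintro τ ⟨k, rfl⟩
      exact MulAction.mem_stabilizer_iff.mp
        ((MulAction.stabilizer (absoluteGaloisGroup (v.adicCompletion ℚ)) x).zpow_mem
          (MulAction.mem_stabilizer_iff.mpr hσ) k)
    exact (IntermediateField.mem_fixingSubgroup_iff _ _).mpr fun y hy ↦
      (IntermediateField.mem_fixedField_iff _ _).mp (hle hy) σ (Subgroup.mem_zpowers σ)
  -- the compact sets `H m \ U`
  by_contra hcon
  have hcon' : ∀ m, ∃ h, h ∈ H m ∧ h • x ≠ x := by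
    intro m
    by_contra hm
    refine hcon ⟨m, fun h hh ↦ ?_⟩
    by_contra hne
    exact hm ⟨h, hh, hne⟩
  let t : ℕ → Set (absoluteGaloisGroup (v.adicCompletion ℚ)) := fun m ↦ (H m : Set _) \ (U : Set _)
  have htd : ∀ m, t (m + 1) ⊆ t m := fun m σ hσ ↦ ⟨hHanti m hσ.1, hσ.2⟩
  have htn : ∀ m, (t m).Nonempty := by
    intro m
    obtain ⟨h, hh, hne⟩ := hcon' m
    exact ⟨h, hh, fun hU ↦ hne (hUfix h hU)⟩
  have htcl : ∀ m, IsClosed (t m) := fun m ↦ ((H m).isClosed_of_isOpen (hHopen m)).sdiff hUopen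
  -- (`CharZero ℚ_v` enters the context only now, for the compactness of `Γ`)
  haveI : CharZero (v.adicCompletion ℚ) :=
    charZero_of_injective_algebraMap (algebraMap ℚ (v.adicCompletion ℚ)).injective
  obtain ⟨σ, hσ⟩ := IsCompact.nonempty_iInter_of_sequence_nonempty_isCompact_isClosed t htd htn
    (htcl 0).isCompact htcl
  rw [Set.mem_iInter] at hσ
  have hσU : σ ∉ U := (hσ 0).2
  have hσi := hHker σ fun m ↦ (hσ m).1
  exact hσU (hfixU σ (hx σ hσi))

/-! ### Orbit products `N_m(w) = ∏_{i<m} g^i w` (complements to BRICK 16a) -/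

section Orbit

variable {K : Type*} [Field K]

/-- **`K̄^N` is `Γ`-stable for `N ⊴ Γ`**: if `x` is fixed by every element of `N`, so is `σ x`. [folklore] -/
theorem smul_mem_fixedField_of_normal (N : Subgroup (absoluteGaloisGroup K)) [hN : N.Normal] {x : AlgebraicClosure K}
    (hx : ∀ h ∈ N, h • x = x) (σ : absoluteGaloisGroup K) : ∀ h ∈ N, h • (σ • x) = σ • x := by
  intro h hh
  have hconj : σ⁻¹ * h * σ⁻¹⁻¹ ∈ N := hN.conj_mem h hh σ⁻¹
  rw [inv_inv] at hconj
  have h1 : (σ⁻¹ * h * σ) • x = x := hx _ hconj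
  rw [mul_smul, mul_smul, inv_smul_eq_iff] at h1
  exact h1

/-- `N_m(w^k) = N_m(w)^k`. [folklore] -/
theorem prod_smul_pow (g : absoluteGaloisGroup K) (m k : ℕ) (w : AlgebraicClosure K) :
    (∏ i ∈ Finset.range m, (g ^ i) • (w ^ k)) = (∏ i ∈ Finset.range m, (g ^ i) • w) ^ k := by
  rw [← Finset.prod_pow]
  exact Finset.prod_congr rfl fun i _ ↦ smul_pow' _ _ _

/-- `g N_m(w) = N_m(w)` when `g^m w = w`. [folklore] -/
theorem smul_prod_smul_eq (g : absoluteGaloisGroup K) (m : ℕ) {w : AlgebraicClosure K} (hw : (g ^ m) • w = w) :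
    g • (∏ i ∈ Finset.range m, (g ^ i) • w) = ∏ i ∈ Finset.range m, (g ^ i) • w := by
  rw [Finset.smul_prod', ← MultTowerNS2.prod_smul_smul_eq g m hw]
  refine Finset.prod_congr rfl fun i _ ↦ ?_
  rw [← mul_smul, ← mul_smul, ← pow_succ, ← pow_succ']

/-- `N_{mk}(w) = N_m(w)^k` when `g^m w = w` (splitting the range `[0, mk)` into `k` blocks of length `m`, each with
product `g^{mj} N_m(w) = N_m(w)`). [folklore] -/
theorem prod_smul_range_mul_eq_pow (g : absoluteGaloisGroup K) (m : ℕ) {w : AlgebraicClosure K}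
    (hw : (g ^ m) • w = w) (k : ℕ) :
    (∏ i ∈ Finset.range (m * k), (g ^ i) • w) = (∏ i ∈ Finset.range m, (g ^ i) • w) ^ k := by
  have hfix : ∀ j : ℕ, (g ^ (m * j)) • (∏ i ∈ Finset.range m, (g ^ i) • w) = ∏ i ∈ Finset.range m, (g ^ i) • w := by
    intro j
    induction j with
    | zero => rw [mul_zero, pow_zero, one_smul]
    | succ j ih => rw [Nat.mul_succ, pow_add, mul_smul, MultTowerNS2.pow_smul_prod_smul_eq g m hw, ih]
  induction k with
  | zero => rw [mul_zero, Finset.prod_range_zero, pow_zero]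
  | succ k ih =>
    rw [Nat.mul_succ, Finset.prod_range_add, ih, pow_succ]
    congr 1
    rw [← hfix k, Finset.smul_prod']
    exact Finset.prod_congr rfl fun i _ ↦ by rw [pow_add, mul_smul]

end Orbit

/-! ### Cyclic Hilbert 90 for `⟨g⟩` acting on `K̄^{H_{n+R}}` -/

/-- **Cyclic Hilbert 90 for the local layer (any `p`).** `κ` the cyclotomic `ℤ_p`-extension, `g ∈ Γ_{ℚ_v}` with
`κ(res g) = p^n u_g` (`u_g` a unit), `F = K̄_v^{H_{n+R}}`: the group `⟨g⟩` acts on `F` through a cyclic group of order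
`p^R`, and an element `u ∈ F` with `∏_{i<p^R} g^i u = 1` is `g(y)/y` for some `y ∈ Fˣ`. Proof: the `p^R` characters
`x ↦ g^i x` of `Fˣ` are distinct (`g^i ∉ H_{n+R} = Gal(K̄/F)` for `0 < i < p^R`), hence linearly independent (Artin;
Mathlib `linearIndependent_monoidHom`), so some Lagrange resolvent `θ = ∑_i (∏_{j<i} g^j u) g^i b` is non-zero; it
satisfies `u · gθ = θ`, and `y = θ⁻¹`. The `p`-general, untwisted form of
`MultTowerNS2.exists_eq_smul_div_of_prod_smul_eq_one`. [cite: NeukirchANT1999, Ch. IV (3.5)] -/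
theorem exists_eq_smul_div_of_prod_smul_eq_one (v : HeightOneSpectrum (𝓞 ℚ)) (n R : ℕ)
    {g : absoluteGaloisGroup (v.adicCompletion ℚ)} {ug : ℤ_[p]ˣ}
    (hug : ((κ (resGal (K := ℚ) (v.adicCompletion ℚ) g)).toAdd : ℤ_[p]) = (p : ℤ_[p]) ^ n * (ug : ℤ_[p]))
    {u : AlgebraicClosure (v.adicCompletion ℚ)}
    (hu : ∀ h ∈ localSubgroup (κ.layerSubgroup (n + R)) (v.adicCompletion ℚ), h • u = u)
    (hN : (∏ i ∈ Finset.range (p ^ R), (g ^ i) • u) = 1) :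
    ∃ y : AlgebraicClosure (v.adicCompletion ℚ), y ≠ 0 ∧
      (∀ h ∈ localSubgroup (κ.layerSubgroup (n + R)) (v.adicCompletion ℚ), h • y = y) ∧
      u = g • y / y := by
  -- the field `F = K̄^{H_{n+R}}`
  set Hm := localSubgroup (κ.layerSubgroup (n + R)) (v.adicCompletion ℚ) with hHm
  haveI hnormal : Hm.Normal := by rw [hHm, localSubgroup_eq_comap]; exact Subgroup.Normal.comap inferInstance _
  let M : IntermediateField (v.adicCompletion ℚ) (AlgebraicClosure (v.adicCompletion ℚ)) :=
    IntermediateField.fixedField Hm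
  have hmemM : ∀ x, x ∈ M ↔ ∀ h ∈ Hm, h • x = x := by
    intro x
    rw [IntermediateField.mem_fixedField_iff]
    constructor
    · intro hx h hh
      exact hx h hh
    · intro hx f hf
      let f' : absoluteGaloisGroup (v.adicCompletion ℚ) := f
      have hf' : f' ∈ Hm := hf
      exact hx f' hf'
  have hstab : ∀ σ : absoluteGaloisGroup (v.adicCompletion ℚ), ∀ x ∈ M, σ • x ∈ M := fun σ x hx ↦
    (hmemM _).mpr (smul_mem_fixedField_of_normal Hm ((hmemM x).mp hx) σ)
  have hgi : ∀ i : ℕ, g ^ i ∈ Hm ↔ p ^ R ∣ i := pow_mem_localSubgroup_layerSubgroup_iff (κ := κ) v n R hug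
  have hgRM : ∀ x ∈ M, (g ^ p ^ R) • x = x := fun x hx ↦ (hmemM x).mp hx _ ((hgi _).mpr dvd_rfl)
  have huM : u ∈ M := (hmemM u).mpr hu
  have hopen : IsOpen (Hm : Set (absoluteGaloisGroup (v.adicCompletion ℚ))) :=
    MultTowerNS2.isOpen_localSubgroup _ (κ.isOpen_layerSubgroup (n + R)) _
  -- `u ≠ 0`
  have hR0 : 0 < p ^ R := pow_pos (Fact.out : p.Prime).pos R
  have hu0 : u ≠ 0 := by
    intro h0
    have hz : (∏ i ∈ Finset.range (p ^ R), (g ^ i) • u) = 0 :=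
      Finset.prod_eq_zero (Finset.mem_range.mpr hR0) (by rw [h0, smul_zero])
    rw [hz] at hN
    exact zero_ne_one hN
  -- (`CharZero ℚ_v` from here on; no term mentioning `localSubgroup` is written after this point)
  haveI : CharZero (v.adicCompletion ℚ) :=
    charZero_of_injective_algebraMap (algebraMap ℚ (v.adicCompletion ℚ)).injective
  have hfix := fixingSubgroup_fixedField_of_isOpen _ hopen
  have hHfix := fun σ ↦ SetLike.ext_iff.mp hfix σ
  -- the characters `x ↦ g^i x` of `M`, `i < p^R`, are distinct
  let χ : Fin (p ^ R) → (M →* AlgebraicClosure (v.adicCompletion ℚ)) := fun i ↦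
    { toFun := fun x ↦ (g ^ (i : ℕ)) • (x : AlgebraicClosure (v.adicCompletion ℚ))
      map_one' := by simp
      map_mul' := fun x y ↦ by
        rw [IntermediateField.coe_mul]
        exact smul_mul' _ _ _ }
  have hχapp : ∀ (i : Fin (p ^ R)) (x : M), χ i x = (g ^ (i : ℕ)) • (x : AlgebraicClosure (v.adicCompletion ℚ)) :=
    fun _ _ ↦ rfl
  have key : ∀ i i' : Fin (p ^ R), (i : ℕ) < i' → χ i = χ i' → False := by
    intro i i' hlt heq
    set d : ℕ := (i' : ℕ) - i with hd
    have hd0 : 0 < d := by omega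
    have hdlt : d < p ^ R := by omega
    have hgd : g ^ d ∉ Hm := by
      rw [hgi]
      intro hdvd
      exact absurd (Nat.le_of_dvd hd0 hdvd) (by omega)
    -- some `b ∈ F` is moved by `g^d`
    have hnot : ¬ ∀ b : M, (g ^ d) • (b : AlgebraicClosure (v.adicCompletion ℚ)) = b := by
      intro hall
      exact hgd ((hHfix (g ^ d)).mp ((mem_fixingSubgroup_iff_forall_smul M (g ^ d)).mpr hall))
    push Not at hnot
    obtain ⟨b, hgb⟩ := hnot
    have h1 := DFunLike.congr_fun heq b
    rw [hχapp, hχapp] at h1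
    rw [show (i' : ℕ) = (i : ℕ) + d by omega, pow_add, mul_smul] at h1
    exact hgb (smul_left_cancel (g ^ (i : ℕ)) h1.symm)
  have hχinj : Function.Injective χ := by
    intro i i' h
    rcases lt_trichotomy (i : ℕ) i' with hlt | heq | hgt
    · exact (key i i' hlt h).elim
    · exact Fin.ext heq
    · exact (key i' i hgt h.symm).elim
  -- Artin: the characters are linearly independent, so some Lagrange resolvent is non-zero
  have hli := (linearIndependent_monoidHom M (AlgebraicClosure (v.adicCompletion ℚ))).comp χ hχinj
  let c : ℕ → AlgebraicClosure (v.adicCompletion ℚ) := fun i ↦ ∏ j ∈ Finset.range i, (g ^ j) • u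
  have hc0 : c 0 = 1 := Finset.prod_range_zero _
  have hcN : c (p ^ R) = 1 := hN
  obtain ⟨b, hb⟩ : ∃ b : M,
      (∑ i : Fin (p ^ R), c i * (g ^ (i : ℕ)) • (b : AlgebraicClosure (v.adicCompletion ℚ))) ≠ 0 := by
    by_contra hall
    push Not at hall
    have hsum : (∑ i : Fin (p ^ R), c i • ((χ i : M →* AlgebraicClosure (v.adicCompletion ℚ)) :
        M → AlgebraicClosure (v.adicCompletion ℚ))) = 0 := by
      funext x
      rw [Finset.sum_apply, Pi.zero_apply]
      simp only [Pi.smul_apply, smul_eq_mul]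
      exact hall x
    have h0 := Fintype.linearIndependent_iff.mp hli (fun i ↦ c i) hsum ⟨0, hR0⟩
    exact one_ne_zero (hc0 ▸ h0)
  -- the resolvent `θ` and the identity `u · gθ = θ`
  set θ : AlgebraicClosure (v.adicCompletion ℚ) :=
    ∑ i ∈ Finset.range (p ^ R), c i * (g ^ i) • (b : AlgebraicClosure (v.adicCompletion ℚ)) with hθ
  have hθb : (∑ i : Fin (p ^ R), c i * (g ^ (i : ℕ)) • (b : AlgebraicClosure (v.adicCompletion ℚ))) = θ :=
    Fin.sum_univ_eq_sum_range (fun i ↦ c i * (g ^ i) • (b : AlgebraicClosure (v.adicCompletion ℚ))) (p ^ R)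
  have hθ0 : θ ≠ 0 := hθb ▸ hb
  have hshift : ∀ i : ℕ, u * (g • c i) = c (i + 1) := by
    intro i
    change u * (g • ∏ j ∈ Finset.range i, (g ^ j) • u) = ∏ j ∈ Finset.range (i + 1), (g ^ j) • u
    rw [Finset.prod_range_succ', pow_zero, one_smul, Finset.smul_prod', mul_comm]
    congr 1
    exact Finset.prod_congr rfl fun j _ ↦ by rw [← mul_smul, ← pow_succ']
  have hgb : (g ^ p ^ R) • (b : AlgebraicClosure (v.adicCompletion ℚ)) = b := hgRM _ b.2
  have hkey : u * (g • θ) = θ := by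
    have h1 : u * (g • θ) = ∑ i ∈ Finset.range (p ^ R), c (i + 1) * (g ^ (i + 1)) •
        (b : AlgebraicClosure (v.adicCompletion ℚ)) := by
      rw [hθ, Finset.smul_sum, Finset.mul_sum]
      refine Finset.sum_congr rfl fun i _ ↦ ?_
      rw [smul_mul', ← mul_assoc, hshift i, ← mul_smul, ← pow_succ']
    have h2 := Finset.sum_range_succ' (fun i ↦ c i * (g ^ i) • (b : AlgebraicClosure (v.adicCompletion ℚ))) (p ^ R)
    have h3 := Finset.sum_range_succ (fun i ↦ c i * (g ^ i) • (b : AlgebraicClosure (v.adicCompletion ℚ))) (p ^ R)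
    rw [h1]
    simp only [pow_zero, one_smul, hc0, one_mul] at h2
    rw [h3, hcN, hgb, one_mul, ← hθ] at h2
    linear_combination -h2
  -- `y = θ⁻¹`
  have hgθ0 : g • θ ≠ 0 := by
    intro h0
    rw [h0, mul_zero] at hkey
    exact hθ0 hkey.symm
  have hθM : θ ∈ M := by
    rw [hθ]
    refine sum_mem fun i _ ↦ mul_mem ?_ (hstab _ _ b.2)
    exact prod_mem fun j _ ↦ hstab _ _ huM
  refine ⟨θ⁻¹, inv_ne_zero hθ0, fun h hh ↦ ?_, ?_⟩
  · rw [smul_inv'', (hmemM θ).mp hθM h hh]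
  · rw [smul_inv'', eq_div_iff (inv_ne_zero hθ0)]
    field_simp
    linear_combination hkey

end Summit.BirchSwinnertonDyer.BirchSwinnertonDyer.Theorems.MultTowerSP1

end
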